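import Mathlib
import Summits.Ventures.PercRepro.TriangleCapPairIdentity
import Summits.Ventures.PercRepro.TriangleCapThirdBest
import Summits.Ventures.PercRepro.TriangleCapMaxDegStability
import Summits.Ventures.PercRepro.TriangleCapStarStability

/-!
# PercRepro — THE THIRD-BEST LOCUS OF THE `K₄⁻`-FREE CHERRY TABLE: on every cell `r ≥ 6` (off the corner ties) a
graph at `closed − 2 (r − 1)` is `K_{a,k−a}` minus an `(r − 1)`-star minus one pair DISJOINT from the star
(p3, gen 50; part 210)

The pair count of a graph `H` with `s` edges (`sum_deg_sq_add_disjEdgePairs`: `Σ h² + disjEdgePairs H = s (s + 1)`)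
sits at `2 (s − 1)` only in one way.  Let `w` have maximum degree `Δ`.  `Δ = s`: all edges at `w`, `Σ h² = s (s + 1)`
(`sum_deg_sq_eq_of_deg_eq_card`).  `Δ ≤ s − 2`: `Σ h² + 4 (s − 3) ≤ s (s + 1)` (`sum_deg_sq_le_of_maxdeg`), too
low for `s ≥ 6`.  `Δ = s − 1`: exactly one edge `e` avoids `w` (`exists_edge_not_mem`, `mem_of_ne_of_deg_eq_pred`),
and if an end `u` of `e` were adjacent to `w` then `d(u) ≥ 2` and the two-vertex bound
`Σ h² + d(w) + d(u) ≥ d(w)² + d(u)² + Σ h` (`sum_deg_sq_ge_two_vertices`) puts `Σ h²` at the broom value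
`≥ s (s + 1) − 2 (s − 2)` (`sum_deg_sq_ge_of_adj`).  Hence (`star_plus_pair_of_sum_deg_sq`) `H` is an `(s − 1)`-star
at `w` plus an edge `e` none of whose ends is a neighbour of `w`.

On the cell: a `K₄⁻`-free graph at `closed − 2 (r − 1)` is `a`-bipartite when `2 a + r + 1 ≤ k` (the non-bipartite
gap `stabGapFull k a r` exceeds `2 (r − 1)` off the corner `k = 2 a + r`, `stabGapFull_gt_two_mul`), and its missing
graph has `r` edges and the pair count `2 (r − 1)` (the bipartite spectrum), so **`cherry_third_best_locus`**:
the missing pairs form an `(r − 1)`-star at a vertex `w` plus ONE pair disjoint from the star.  Conversely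
(`sum_deg_sq_of_star_plus_pair`) every such missing graph sits exactly at the value.

Axioms: standard.
-/

namespace PercRepro

namespace TriangleCap

namespace C047

open Finset

variable {V : Type*} [Fintype V] [DecidableEq V]

omit [DecidableEq V] in
/-- **THE TWO-VERTEX BOUND:** `d(w)² + d(x)² + Σ_v d(v) ≤ Σ_v d(v)² + d(w) + d(x)` for `w ≠ x` (the other vertices
contribute `d(v)² ≥ d(v)`). -/
theorem sum_deg_sq_ge_two_vertices (H : SimpleGraph V) [DecidableRel H.Adj] (w x : V) (hwx : w ≠ x) :
    deg H w * deg H w + deg H x * deg H x + ∑ v, deg H v ≤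
      ∑ v, deg H v * deg H v + deg H w + deg H x := by
  classical
  have hx : x ∈ (univ : Finset V).erase w := mem_erase.mpr ⟨hwx.symm, mem_univ x⟩
  have e1 := add_sum_erase (univ : Finset V) (fun v => deg H v * deg H v) (mem_univ w)
  have e2 := add_sum_erase ((univ : Finset V).erase w) (fun v => deg H v * deg H v) hx
  have f1 := add_sum_erase (univ : Finset V) (fun v => deg H v) (mem_univ w)
  have f2 := add_sum_erase ((univ : Finset V).erase w) (fun v => deg H v) hx
  have hle : ∑ v ∈ ((univ : Finset V).erase w).erase x, deg H v ≤
      ∑ v ∈ ((univ : Finset V).erase w).erase x, deg H v * deg H v :=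
    sum_le_sum (fun v _ => Nat.le_mul_self _)
  omega

omit [DecidableEq V] in
/-- **THE ONE-VERTEX BOUND:** `d(w)² + Σ_v d(v) ≤ Σ_v d(v)² + d(w)`. -/
theorem sum_deg_sq_ge_one_vertex (H : SimpleGraph V) [DecidableRel H.Adj] (w : V) :
    deg H w * deg H w + ∑ v, deg H v ≤ ∑ v, deg H v * deg H v + deg H w := by
  classical
  have e1 := add_sum_erase (univ : Finset V) (fun v => deg H v * deg H v) (mem_univ w)
  have f1 := add_sum_erase (univ : Finset V) (fun v => deg H v) (mem_univ w)
  have hle : ∑ v ∈ (univ : Finset V).erase w, deg H v ≤ ∑ v ∈ (univ : Finset V).erase w, deg H v * deg H v :=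
    sum_le_sum (fun v _ => Nat.le_mul_self _)
  omega

/-- A vertex carrying every edge (`d(w) = s`) forces the star value `Σ_v d(v)² = s (s + 1)`. -/
theorem sum_deg_sq_eq_of_deg_eq_card (H : SimpleGraph V) [DecidableRel H.Adj] (w : V)
    (hw : deg H w = H.edgeFinset.card) :
    ∑ v, deg H v * deg H v = H.edgeFinset.card * (H.edgeFinset.card + 1) := by
  have h1 := sum_deg_sq_ge_one_vertex H w
  have h2 := sum_deg_sq_le_star H
  have h3 := sum_deg_eq H
  rw [hw] at h1
  rw [Nat.mul_add, mul_one] at h2 ⊢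
  omega

/-- `d(w) < s` ⇒ some edge avoids `w`. -/
theorem exists_edge_not_mem (H : SimpleGraph V) [DecidableRel H.Adj] (w : V)
    (hw : deg H w < H.edgeFinset.card) : ∃ e ∈ H.edgeFinset, w ∉ e := by
  by_contra hcon
  have hall : ∀ e ∈ H.edgeFinset, w ∈ e := fun e he => by_contra (fun h => hcon ⟨e, he, h⟩)
  have hsub : H.edgeFinset ⊆ H.incidenceFinset w := fun e he => by
    rw [SimpleGraph.mem_incidenceFinset]
    exact ⟨SimpleGraph.mem_edgeFinset.mp he, hall e he⟩
  have := card_le_card hsub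
  rw [SimpleGraph.card_incidenceFinset_eq_degree, ← deg_eq_degree] at this
  omega

/-- `d(w) = s − 1` and `e` an edge avoiding `w` ⇒ every other edge contains `w`. -/
theorem mem_of_ne_of_deg_eq_pred (H : SimpleGraph V) [DecidableRel H.Adj] (w : V)
    (hw : deg H w + 1 = H.edgeFinset.card) (e : Sym2 V) (he : e ∈ H.edgeFinset) (hwe : w ∉ e) :
    ∀ f ∈ H.edgeFinset, f ≠ e → w ∈ f := by
  have hsub : insert e (H.incidenceFinset w) ⊆ H.edgeFinset := by
    intro f hf
    rw [mem_insert] at hf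
    rcases hf with rfl | hf
    · exact he
    · exact SimpleGraph.mem_edgeFinset.mpr (SimpleGraph.mem_incidenceFinset H w _ |>.mp hf).1
  have hnot : e ∉ H.incidenceFinset w := fun h => hwe (SimpleGraph.mem_incidenceFinset H w _ |>.mp h).2
  have hcard : (insert e (H.incidenceFinset w)).card = H.edgeFinset.card := by
    rw [card_insert_of_notMem hnot, SimpleGraph.card_incidenceFinset_eq_degree, ← deg_eq_degree, hw]
  have heq := eq_of_subset_of_card_le hsub (le_of_eq hcard.symm)
  intro f hf hfe
  rw [← heq, mem_insert] at hf
  rcases hf with rfl | hf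
  · exact absurd rfl hfe
  · exact (SimpleGraph.mem_incidenceFinset H w _ |>.mp hf).2

omit [DecidableEq V] in
/-- Two distinct neighbours give degree `≥ 2`. -/
theorem two_le_deg_of_adj_adj (H : SimpleGraph V) [DecidableRel H.Adj] (u w v : V) (hwv : w ≠ v)
    (h1 : H.Adj u w) (h2 : H.Adj u v) : 2 ≤ deg H u := by
  classical
  unfold deg
  have hsub : ({w, v} : Finset V) ⊆ univ.filter (fun x => H.Adj u x) := by
    intro x hx
    rw [mem_insert, mem_singleton] at hx
    rw [mem_filter]
    rcases hx with rfl | rfl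
    · exact ⟨mem_univ _, h1⟩
    · exact ⟨mem_univ _, h2⟩
  have := card_le_card hsub
  rw [card_pair hwv] at this
  exact this

omit [DecidableEq V] in
/-- **THE BROOM VALUE IS FORCED BY A NEIGHBOUR ON THE EXTRA EDGE:** `d(w) = s − 1`, `w ~ x`, `d(x) ≥ 2` ⇒
`s (s + 1) ≤ Σ_v d(v)² + 2 (s − 2)`. -/
theorem sum_deg_sq_ge_of_adj (H : SimpleGraph V) [DecidableRel H.Adj] (w x : V)
    (hw : deg H w + 1 = H.edgeFinset.card) (hwx : H.Adj w x) (hx2 : 2 ≤ deg H x) :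
    H.edgeFinset.card * (H.edgeFinset.card + 1) ≤ ∑ v, deg H v * deg H v + 2 * (H.edgeFinset.card - 2) := by
  have h1 := sum_deg_sq_ge_two_vertices H w x (H.ne_of_adj hwx)
  have h3 := sum_deg_eq H
  have h4 : deg H x + 2 ≤ deg H x * deg H x := by nlinarith
  have hw1 : 1 ≤ deg H w := by
    have : 2 ≤ deg H x := hx2
    by_contra h0
    have hw0 : deg H w = 0 := by omega
    unfold deg at hw0
    rw [card_eq_zero] at hw0
    have : x ∈ (univ.filter (fun y => H.Adj w y)) := mem_filter.mpr ⟨mem_univ _, hwx⟩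
    rw [hw0] at this
    exact absurd this (Finset.notMem_empty x)
  obtain ⟨d, hd⟩ : ∃ d, deg H w = d + 1 := ⟨deg H w - 1, by omega⟩
  rw [hd] at h1 hw
  rw [← hw]
  have e1 : (d + 1) * (d + 1) = d * d + 2 * d + 1 := by ring
  have e2 : (d + 1 + 1) * (d + 1 + 1 + 1) = d * d + 5 * d + 6 := by ring
  have e3 : d + 1 + 1 - 2 = d := by omega
  rw [e1] at h1
  rw [e2, e3]
  rw [← hw] at h3
  omega

/-- **THE THIRD-BEST LOCUS OF THE PAIR COUNT:** a triangle-free graph with `s ≥ 6` edges and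
`Σ_v d(v)² + 2 (s − 1) = s (s + 1)` (pair count `2 (s − 1)`) is an `(s − 1)`-star at a vertex `w` plus ONE edge `e`
none of whose ends is adjacent to `w`. -/
theorem star_plus_pair_of_sum_deg_sq (H : SimpleGraph V) [DecidableRel H.Adj] (hfree : H.CliqueFree 3)
    (s : ℕ) (hs : 6 ≤ s) (hm : H.edgeFinset.card = s)
    (hS : ∑ v, deg H v * deg H v + 2 * (s - 1) = s * (s + 1)) :
    ∃ w, deg H w + 1 = s ∧ ∃ e ∈ H.edgeFinset, w ∉ e ∧ (∀ u ∈ e, ¬ H.Adj w u) ∧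
      ∀ f ∈ H.edgeFinset, f ≠ e → w ∈ f := by
  have hne : (univ : Finset V).Nonempty := by
    obtain ⟨e, he⟩ := card_pos.mp (by omega : 0 < H.edgeFinset.card)
    revert he
    refine Sym2.ind (fun x y _ => ?_) e
    exact ⟨x, mem_univ x⟩
  obtain ⟨w, -, hwmax⟩ := exists_max_image univ (deg H) hne
  have hwle : deg H w ≤ H.edgeFinset.card := by
    rw [deg_eq_degree, ← SimpleGraph.card_incidenceFinset_eq_degree]
    exact card_le_card (H.incidenceFinset_subset w)
  rcases lt_trichotomy (deg H w + 1) s with hlt | heq | hgt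
  · exfalso
    have hΔ : ∀ v, deg H v + 2 ≤ H.edgeFinset.card := fun v => by
      have := hwmax v (mem_univ v)
      omega
    have := sum_deg_sq_le_of_maxdeg H hfree (by omega) hΔ
    rw [hm] at this
    omega
  · refine ⟨w, heq, ?_⟩
    obtain ⟨e, he, hwe⟩ := exists_edge_not_mem H w (by omega)
    refine ⟨e, he, hwe, ?_, mem_of_ne_of_deg_eq_pred H w (by omega) e he hwe⟩
    intro u hu hadj
    obtain ⟨v, rfl⟩ := Sym2.mem_iff_exists.mp hu
    have huv : H.Adj u v := (SimpleGraph.mem_edgeSet H).mp (SimpleGraph.mem_edgeFinset.mp he)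
    have hwv : w ≠ v := fun h => hwe (h ▸ Sym2.mem_mk_right u v)
    have hu2 : 2 ≤ deg H u := two_le_deg_of_adj_adj H u w v hwv hadj.symm huv
    have := sum_deg_sq_ge_of_adj H w u (by omega) hadj hu2
    rw [hm] at this
    omega
  · exfalso
    have hwr : deg H w = H.edgeFinset.card := by omega
    have := sum_deg_sq_eq_of_deg_eq_card H w hwr
    rw [hm] at this
    omega

/-- **THE CONVERSE:** an `(s − 1)`-star at `w` plus an edge `e` avoiding `w` with no end adjacent to `w` has every
other degree `≤ 1`, so `Σ_v d(v)² + 2 (s − 1) = s (s + 1)`. -/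
theorem sum_deg_sq_of_star_plus_pair (H : SimpleGraph V) [DecidableRel H.Adj] (w : V)
    (hw : deg H w + 1 = H.edgeFinset.card) (e : Sym2 V) (_he : e ∈ H.edgeFinset) (hwe : w ∉ e)
    (hend : ∀ u ∈ e, ¬ H.Adj w u) (hall : ∀ f ∈ H.edgeFinset, f ≠ e → w ∈ f) :
    ∑ v, deg H v * deg H v + 2 * (H.edgeFinset.card - 1) = H.edgeFinset.card * (H.edgeFinset.card + 1) := by
  classical
  -- every vertex other than `w` has degree `≤ 1`
  have hdeg : ∀ v, v ≠ w → deg H v ≤ 1 := by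
    intro v hvw
    by_contra hcon
    have h1 : 1 < deg H v := by omega
    unfold deg at h1
    -- two distinct neighbours `x ≠ y` of `v`
    obtain ⟨x, hx, y, hy, hxy⟩ := one_lt_card.mp h1
    rw [mem_filter] at hx hy
    have hvx : H.Adj v x := hx.2
    have hvy : H.Adj v y := hy.2
    have hex : s(v, x) ∈ H.edgeFinset := SimpleGraph.mem_edgeFinset.mpr ((SimpleGraph.mem_edgeSet H).mpr hvx)
    have hey : s(v, y) ∈ H.edgeFinset := SimpleGraph.mem_edgeFinset.mpr ((SimpleGraph.mem_edgeSet H).mpr hvy)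
    -- the edge `s(v, x)` is `e` or contains `w`; same for `s(v, y)`; both cannot contain `w` (they would coincide)
    have key : ∀ z, H.Adj v z → s(v, z) ≠ e → z = w := by
      intro z hvz hne
      have := hall _ (SimpleGraph.mem_edgeFinset.mpr ((SimpleGraph.mem_edgeSet H).mpr hvz)) hne
      rw [Sym2.mem_iff] at this
      rcases this with h | h
      · exact absurd h.symm hvw
      · exact h.symm
    by_cases hx' : s(v, x) = e
    · -- `v ∈ e`, so `w` is not adjacent to `v`; then `s(v, y) ≠ e` (else `x = y`) forces `y = w`, i.e. `v ~ w`
      have hv_e : v ∈ e := hx' ▸ Sym2.mem_mk_left v x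
      have hy' : s(v, y) ≠ e := by
        intro h
        rw [← hx'] at h
        rw [Sym2.eq_iff] at h
        rcases h with ⟨-, h⟩ | ⟨-, h⟩
        · exact hxy h.symm
        · exact H.ne_of_adj hvy h.symm
      have := key y hvy hy'
      subst this
      exact hend v hv_e hvy.symm
    · have := key x hvx hx'
      subst this
      by_cases hy' : s(v, y) = e
      · have hv_e : v ∈ e := hy' ▸ Sym2.mem_mk_left v y
        exact hend v hv_e hvx.symm
      · have := key y hvy hy'
        exact hxy (this.symm ▸ rfl)
  -- `Σ_{v ≠ w} d(v)² = Σ_{v ≠ w} d(v)`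
  have hsq : ∀ v ∈ (univ : Finset V).erase w, deg H v * deg H v = deg H v := by
    intro v hv
    have h1 := hdeg v (mem_erase.mp hv).1
    interval_cases h : deg H v <;> simp
  have e1 := add_sum_erase (univ : Finset V) (fun v => deg H v * deg H v) (mem_univ w)
  have f1 := add_sum_erase (univ : Finset V) (fun v => deg H v) (mem_univ w)
  have hsum : ∑ v ∈ (univ : Finset V).erase w, deg H v * deg H v = ∑ v ∈ (univ : Finset V).erase w, deg H v :=
    sum_congr rfl hsq
  have h3 := sum_deg_eq H
  obtain ⟨d, hd⟩ : ∃ d, deg H w = d := ⟨_, rfl⟩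
  rw [hd] at hw e1 f1
  rw [← hw]
  have e2 : (d + 1) * (d + 1 + 1) = d * d + 3 * d + 2 := by ring
  have e3 : d + 1 - 1 = d := by omega
  rw [e2, e3]
  rw [← hw] at h3
  omega

/-- **THE NON-BIPARTITE GAP EXCEEDS `2 (r − 1)` OFF THE CORNER:** `3 ≤ a`, `3 ≤ r`, `2 a + r + 1 ≤ k` ⇒
`2 (r − 1) < stabGapFull k a r`. -/
theorem stabGapFull_gt_two_mul (k a r : ℕ) (ha3 : 3 ≤ a) (hr3 : 3 ≤ r) (hk : 2 * a + r + 1 ≤ k) :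
    2 * (r - 1) < stabGapFull k a r := by
  unfold stabGapFull
  by_cases h1 : r + 3 ≤ a
  · rw [if_pos h1]
    have hb1 : r ≤ k - 2 * a - 1 := by omega
    have hb2 : 3 ≤ a - r := by omega
    have := Nat.mul_le_mul (Nat.mul_le_mul_left 2 hb1) hb2
    omega
  · rw [if_neg h1]
    by_cases h2 : r + 1 ≤ a
    · rw [if_pos h2]
      omega
    · rw [if_neg h2]
      apply lt_min
      · have : 0 ≤ 2 * (r - a) * (a - 2) := Nat.zero_le _
        omega
      · have : 0 ≤ 2 * (r - a) * (a - 3) := Nat.zero_le _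
        omega

/-- **THE THIRD-BEST LOCUS OF THE CHERRY TABLE:** on every cell `(k, a, r)` with `3 ≤ a`, `6 ≤ r`, `2 a + r + 1 ≤ k`
(`r + 7 ≤ k` on the row `a = 3`), every `K₄⁻`-free graph with `a (k − a) − r` edges at the third-best value
`Σ_v d(v)² + r (k − 1 − r) + 2 (r − 1) = m k` is a spanning subgraph of some `K(A, Aᶜ)`, `|A| = a`, whose missing
cross pairs form an `(r − 1)`-star at a vertex `w` plus ONE pair `e` none of whose ends is a missing neighbour of `w`
(so `e` is disjoint from the star). -/
theorem cherry_third_best_locus (k a r : ℕ) (ha3 : 3 ≤ a) (hr6 : 6 ≤ r) (hk : 2 * a + r + 1 ≤ k)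
    (hk3 : a = 3 → r + 7 ≤ k) (D : SimpleGraph (Fin k)) [DecidableRel D.Adj] (hK : K4mFree D)
    (hm : D.edgeFinset.card + r = a * (k - a))
    (heq : ∑ v, deg D v * deg D v + r * (k - 1 - r) + 2 * (r - 1) = D.edgeFinset.card * k) :
    ∃ A : Finset (Fin k), A.card = a ∧ BipSub D A ∧
      ∃ w, deg (missingGraph D A) w + 1 = r ∧ ∃ e ∈ (missingGraph D A).edgeFinset, w ∉ e ∧
        (∀ u ∈ e, ¬ (missingGraph D A).Adj w u) ∧ ∀ f ∈ (missingGraph D A).edgeFinset, f ≠ e → w ∈ f := by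
  have hcard : Fintype.card (Fin k) = k := Fintype.card_fin k
  -- `D` is `a`-bipartite: otherwise the non-bipartite gap `stabGapFull k a r > 2 (r − 1)` applies
  have hbip : ∃ A : Finset (Fin k), A.card = a ∧ BipSub D A := by
    by_contra hnb
    have h := (stab_table_rows_ge_three k a r ha3 (by omega) (by omega) hk3).1 D hK hm hnb
    have := stabGapFull_gt_two_mul k a r ha3 (by omega) hk
    omega
  obtain ⟨A, hA, hB⟩ := hbip
  refine ⟨A, hA, hB, ?_⟩
  have hH := bipSub_sum_deg_sq_add_disjEdgePairs D A hB a r hA (by rw [hcard]; exact hm) (by rw [hcard]; omega)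
  rw [hcard] at hH
  have hr : (missingGraph D A).edgeFinset.card = r := card_edges_missingGraph D A hB a r hA (by rw [hcard]; exact hm)
  have hid := sum_deg_sq_add_disjEdgePairs (missingGraph D A)
  rw [hr] at hid
  have hS : ∑ v, deg (missingGraph D A) v * deg (missingGraph D A) v + 2 * (r - 1) = r * (r + 1) := by
    omega
  exact star_plus_pair_of_sum_deg_sq (missingGraph D A) (cliqueFree_of_bipSub _ A (bipSub_missingGraph D A)) r hr6
    hr hS

/-- **THE CONVERSE ON THE CELL:** an `a`-bipartite `K₄⁻`-free graph whose missing pairs form an `(r − 1)`-star at `w`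
plus one pair with no end a missing neighbour of `w` sits exactly at the third-best value. -/
theorem cherry_third_best_of_star_plus_pair (k a r : ℕ) (hk : r + 1 ≤ k) (D : SimpleGraph (Fin k))
    [DecidableRel D.Adj] (A : Finset (Fin k)) (hA : A.card = a) (hB : BipSub D A)
    (hm : D.edgeFinset.card + r = a * (k - a)) (w : Fin k) (hw : deg (missingGraph D A) w + 1 = r)
    (e : Sym2 (Fin k)) (he : e ∈ (missingGraph D A).edgeFinset) (hwe : w ∉ e)
    (hend : ∀ u ∈ e, ¬ (missingGraph D A).Adj w u)
    (hall : ∀ f ∈ (missingGraph D A).edgeFinset, f ≠ e → w ∈ f) :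
    ∑ v, deg D v * deg D v + r * (k - 1 - r) + 2 * (r - 1) = D.edgeFinset.card * k := by
  have hcard : Fintype.card (Fin k) = k := Fintype.card_fin k
  have hr : (missingGraph D A).edgeFinset.card = r := card_edges_missingGraph D A hB a r hA (by rw [hcard]; exact hm)
  have hH := bipSub_sum_deg_sq_add_disjEdgePairs D A hB a r hA (by rw [hcard]; exact hm) (by rw [hcard]; exact hk)
  rw [hcard] at hH
  have hid := sum_deg_sq_add_disjEdgePairs (missingGraph D A)
  have hval := sum_deg_sq_of_star_plus_pair (missingGraph D A) w (by rw [hr]; exact hw) e he hwe hend hall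
  rw [hr] at hid hval
  omega

end C047

end TriangleCap

end PercRepro
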